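import Summits.QuantumFields.BalabanUV.Beta.CovariantTowerL2
import Literature.MathematicalPhysics.QuantumFieldTheory.Balaban1983to89.B9Thm37GlueTorusCovTowerPU

/-!
# Beta / CovariantTowerRemainder — EACH PARAMETRIX REMAINDER TERM K(h_□)G′_□h_□ OF [B9] (3.88)–(3.90) FOR THE k-FOLD
# COVARIANT TOWER OPERATOR IS O(1/M₀) IN ℓ², uniformly in the transport U and in the volume (M₀ = the scale of the
# partition of unity): the per-box half of the (3.89) smallness, with explicit constants
# (unit `b2b-balaban-beta-d4-p2`, GEN 4; node (m1), second half, of `beta/skeletons/D4-NODE-O2-b2b-balaban-beta-d4-p2.md`;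
# imports `CovariantTowerL2` and pv21's `B9Thm37GlueTorusCovTowerPU` only)

HONEST FRAMING: discharging `BetaPertH` makes Bałaban's UV stability UNCONDITIONAL — NOT the continuum limit, NOT the
Clay problem.  HONEST DEPENDENCY (verbatim): «continuum YM on T⁴ ⇐ BetaPertH ∧ nine spine estimates (0/9 proved);
BetaPertH ⇐ (D1) ∧ (D4) ∧ CAP+tail; G-an2-4 gates asym, D1 and NE2/3/4.»  THIS MODULE DISCHARGES NOTHING of `BetaPertH`,
asserts NOTHING printed and cites nothing as a fact (ABSOLUTE RULE): [folklore] kernel theorems about the component MODEL of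
the pv21 chain ([B9] = `Balaban1985BackgroundPropagators`, Commun. Math. Phys. 99 (1985) 389–434; SHAPES: K(h) of (3.88)
p. 409, R′ = Σ_□K(h_□)G′_□h_□ of (3.89)–(3.90), the partition of unity of [B5] (1.118)).

CONTENT (Δ′ := the tower operator `towerOp`; K(h) := pv21's CONCRETE `towerK … h` = (leibRemT h)∇_U − ∇_U\*(leibRem h) +
[M_h, Σ_{l≤k} a_lG_lᵀG_l]; G′_□ := `dirInv Δ′ Ω₀(□)`; `L2Bound` of `CovariantTowerL2`).
* §1 `l2Bound_comm_towerLevelSum`: ‖[M_h, Σ_l a_lG_lᵀG_l]‖ ≤ Σ_l a_l·2w_max²N_l·m_l whenever |h(x) − h(towerBlk_l x)| ≤ m_l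
  (per level `CovariantTowerL2.l2Bound_comm_gMeanSq` with φ̄ := h at the representatives; levels summed with the a_l ≥ 0).
* §2 `l2Bound_towerK`: ‖K(h)‖ ≤ 4c_maxθz + Σ_l a_l·2w_max²N_l·m_l for |c(b)(h(b₊) − h(b₋))| ≤ θ (Leibniz parts:
  `l2Bound_leibRem(T)` ∘ `l2Bound_covD(T)`); `l2Bound_dirInv_tower`: ‖G′_□‖ ≤ σ_k⁻¹ (pv21 `towerDir_sq_le`);
  **`l2Bound_remainderTerm`**: ‖K(h)G′_□M_h‖ ≤ (4c_maxθz + Σ_l a_l·2w_max²N_l·m_l)·σ_k⁻¹ for |h| ≤ 1.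
* §3 THE TORUS with the b05 partition of unity h_z = `hSU N M₀ z` ([B5] (1.118); 4d/M₀-Lipschitz per bond, 0 ≤ h ≤ 1) and
  the cube-comb tower: θ = c_max·4d/M₀, m_l = S_l·4d/M₀ (`CovariantTowerDecay.abs_sub_towerBlk_le`), z = d, whence
  **`remainderTerm_le_torus`**: ‖K(h_z)G′_zM_{h_z}v‖ ≤ (C_rem/M₀)·‖v‖ with
  C_rem = 4d·(4c_max²d + 2w_max²Σ_l a_lN_lS_l)·σ_k⁻¹ INDEPENDENT of N, U, M₀ and z — for every torus, every isometric
  transport, every centre z (`remConstTower`); `_top` version with the cover discharged by the top level.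

WHAT IS NOT HERE (honest scope).  The SUM over the boxes z — ‖R′‖ = ‖Σ_z K(h_z)G′_zh_z‖ ≤ ν·C_rem/M₀ with ν the
overlap number of the regions Ω₀(z) — is the GEOMETRIC half of (3.89) (finite overlap of the block hulls `omegaBall` on
the M₀-grid, needs the top averaging block small against M₀) and is NOT proved here; hence no «‖R′‖ < 1 for M₀ large», no
Neumann series, nothing of Thm 3.7.  Constants crude and k-DEPENDENT (σ_k, item (v) of the O.2 skeleton); ℓ² currency only.
Row D4: RECORDS value (node (m1) of the O.2 skeleton, per-box half); class of (T3)/NODE O.2 unchanged; D4 DISCHARGE NO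
DATE; NOT BetaPertH, NOT continuum, NOT Clay.
-/

namespace Summit.QuantumFields.BalabanUV.Beta.CovariantTowerRemainder

open Finset
open Literature.MathematicalPhysics.QuantumFieldTheory.Balaban1983to89
open B9Thm37Sum B9Thm37Glue B9Thm37GluePU B9Thm37GlueTorusInv B9Thm37GlueTorusCov B9Thm37GlueTorusCovComp
open B9Thm37GlueTorusCovPoinc (tdepth_le card_block_le)
open B9Thm37GlueTorusCovLevels B9Thm37GlueTorusCovLevelsPoinc B9Thm37GlueTorusCovTower B9Thm37GlueTorusCovTowerDir
open B9Thm37GlueTorusCovTowerPU (towerK omegaBall omegaBall_zero_or_one)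
open Summit.QuantumFields.BalabanUV.Beta.CovariantTowerDecay (towerS towerS_zero towerS_succ abs_sub_towerBlk_le)
open Summit.QuantumFields.BalabanUV.Beta.CovariantTowerL2
open B5TorusCover (UT Ctr ctrU)
open B5SmoothPartition (hSU hSU_lipschitz)
open B9Thm37GlueTorusCovCT (card_filter_bsrc_le card_filter_btgt_le)
open B5Leibniz121 (up dist_up_le)

noncomputable section

/-! ## §1  The commutator of M_h with the tower's level sum -/

section Tower

variable {St Bd Cp : Type} [Fintype St] [DecidableEq St] [Fintype Bd] [Fintype Cp] [DecidableEq Cp]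
  {src tgt : Bd → St} {Bs : ℕ → Type} [∀ j, Fintype (Bs j)] [∀ j, DecidableEq (Bs j)]
  (Ks : ∀ j, Comb src tgt (Bs j)) (Rm : Bd → Cp → Cp → ℝ)

omit [Fintype Bd] [∀ j, Fintype (Bs j)] in
/-- **‖[M_h, Σ_{l≤k} a_lG_lᵀG_l]‖ ≤ Σ_l a_l·2w_max²N_l·m_l** for the tower's level sum (SITE weights |W_l| ≤ w_max, a_l ≥ 0,
isometric bond matrices, combs K_j with blocks of ≤ n_j sites so that level l has blocks of ≤ N_l = `towerN n l` sites)
whenever |h(x) − h(towerBlk_l x)| ≤ m_l (m_l ≥ 0) for every level: the commutator M_h∘L − L∘M_h, L the level sum.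
[folklore] -/
theorem l2Bound_comm_towerLevelSum (hRm : ∀ b i j, ∑ k, Rm b k i * Rm b k j = if i = j then (1 : ℝ) else 0)
    {n : ℕ → ℕ} (hn : ∀ j β, (univ.filter fun x => (Ks j).blk x = β).card ≤ n j) (k : ℕ)
    {W : Fin (k + 1) → St → ℝ} {wmax : ℝ} (hwmax : 0 ≤ wmax) (hW : ∀ l x, |W l x| ≤ wmax)
    {a : Fin (k + 1) → ℝ} (ha : ∀ l, 0 ≤ a l) (h : St → ℝ) {m : Fin (k + 1) → ℝ} (hm : ∀ l, 0 ≤ m l)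
    (hδ : ∀ (l : Fin (k + 1)) x, |h x - h (towerBlk Ks (l : ℕ) x)| ≤ m l) :
    L2Bound (mulOp (h ∘ Prod.fst) *
        levelSum (fun l : Fin (k + 1) => towerBlk Ks (l : ℕ)) W (fun l => towerTr Ks Rm (l : ℕ)) a -
      levelSum (fun l : Fin (k + 1) => towerBlk Ks (l : ℕ)) W (fun l => towerTr Ks Rm (l : ℕ)) a *
        mulOp (h ∘ Prod.fst))
      (∑ l : Fin (k + 1), a l * (2 * (wmax ^ 2 * (towerN n l : ℝ)) * m l)) := by
  -- the commutator as a sum over the levels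
  set Q : Fin (k + 1) → Module.End ℝ (St × Cp → ℝ) := fun l =>
    gMeanT (towerBlk Ks (l : ℕ)) (W l) (towerTr Ks Rm (l : ℕ)) ∘ₗ gMean (towerBlk Ks (l : ℕ)) (W l) (towerTr Ks Rm (l : ℕ))
    with hQ
  have hL : levelSum (fun l : Fin (k + 1) => towerBlk Ks (l : ℕ)) W (fun l => towerTr Ks Rm (l : ℕ)) a =
      ∑ l, a l • Q l := rfl
  have hcomm : mulOp (h ∘ Prod.fst) *
        levelSum (fun l : Fin (k + 1) => towerBlk Ks (l : ℕ)) W (fun l => towerTr Ks Rm (l : ℕ)) a -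
      levelSum (fun l : Fin (k + 1) => towerBlk Ks (l : ℕ)) W (fun l => towerTr Ks Rm (l : ℕ)) a *
        mulOp (h ∘ Prod.fst) =
      ∑ l, a l • -(Q l ∘ₗ mulOp (h ∘ Prod.fst) - mulOp (h ∘ Prod.fst) ∘ₗ Q l) := by
    rw [hL, Finset.mul_sum, Finset.sum_mul, ← Finset.sum_sub_distrib]
    refine Finset.sum_congr rfl fun l _ => ?_
    rw [mul_smul_comm, smul_mul_assoc, neg_sub, smul_sub]
    rfl
  refine L2Bound.of_eq ?_ hcomm.symm
  refine L2Bound.sum univ fun l _ => ?_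
  have hb := (l2Bound_comm_gMeanSq (towerBlk Ks (l : ℕ)) (W l) (towerTr Ks Rm (l : ℕ)) hwmax (hW l)
    (towerTr_orth Ks Rm hRm (l : ℕ)) (card_towerBlk_fibre_le Ks hn (l : ℕ)) h h (hm l) (hδ l)).neg
  have e : |a l| * (2 * (wmax ^ 2 * (towerN n l : ℝ)) * m l) = a l * (2 * (wmax ^ 2 * (towerN n l : ℝ)) * m l) := by
    rw [abs_of_nonneg (ha l)]
  exact (hb.smul (a l)).mono (le_of_eq e)

/-! ## §2  K(h), the Dirichlet local inverse and the remainder term K(h)G′_□M_h in ℓ² -/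

omit [∀ j, Fintype (Bs j)] in
/-- **‖K(h)‖ ≤ 4c_maxθz + Σ_l a_l·2w_max²N_l·m_l** for pv21's concrete K(h) = (leibRemT h)∇_U − ∇_U\*(leibRem h) +
[M_h, level sum] of the tower: |c(b)(h(b₊) − h(b₋))| ≤ θ, |c| ≤ c_max, bond degrees ≤ z, and the hypotheses of
`l2Bound_comm_towerLevelSum`. [folklore] -/
theorem l2Bound_towerK (hRm : ∀ b i j, ∑ k, Rm b k i * Rm b k j = if i = j then (1 : ℝ) else 0)
    {c : Bd → ℝ} {cmax : ℝ} (hcmax : 0 ≤ cmax) (hc' : ∀ b, |c b| ≤ cmax) {z : ℕ}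
    (hzs : ∀ x, (univ.filter fun b => src b = x).card ≤ z) (hzt : ∀ x, (univ.filter fun b => tgt b = x).card ≤ z)
    {n : ℕ → ℕ} (hn : ∀ j β, (univ.filter fun x => (Ks j).blk x = β).card ≤ n j) (k : ℕ)
    {W : Fin (k + 1) → St → ℝ} {wmax : ℝ} (hwmax : 0 ≤ wmax) (hW : ∀ l x, |W l x| ≤ wmax)
    {a : Fin (k + 1) → ℝ} (ha : ∀ l, 0 ≤ a l) (h : St → ℝ) {θ : ℝ} (hθ : 0 ≤ θ)
    (hdh : ∀ b, |c b * (h (tgt b) - h (src b))| ≤ θ) {m : Fin (k + 1) → ℝ} (hm : ∀ l, 0 ≤ m l)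
    (hδ : ∀ (l : Fin (k + 1)) x, |h x - h (towerBlk Ks (l : ℕ) x)| ≤ m l) :
    L2Bound (towerK Ks Rm c k W a h)
      (4 * cmax * θ * z + ∑ l : Fin (k + 1), a l * (2 * (wmax ^ 2 * (towerN n l : ℝ)) * m l)) := by
  have h1 : L2Bound (leibRemT src tgt c h ∘ₗ covD src tgt c Rm) (θ * Real.sqrt z * (2 * cmax * Real.sqrt z)) :=
    (l2Bound_leibRemT src tgt c h hθ hdh hzs).comp (l2Bound_covD src tgt c Rm hRm hcmax hc' hzs hzt)
  have h2 : L2Bound (-(covDT src tgt c Rm ∘ₗ leibRem src tgt c h)) (2 * cmax * Real.sqrt z * (θ * Real.sqrt z)) :=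
    ((l2Bound_covDT src tgt c Rm hRm hcmax hc' hzs hzt).comp (l2Bound_leibRem src tgt c h hθ hdh hzs)).neg
  have h3 := l2Bound_comm_towerLevelSum Ks Rm hRm hn k hwmax hW ha h hm hδ
  have hK := h1.add (h2.add h3)
  refine (hK.of_eq rfl).mono (le_of_eq ?_)
  have hz : Real.sqrt z * Real.sqrt z = z := Real.mul_self_sqrt (Nat.cast_nonneg z)
  calc θ * Real.sqrt z * (2 * cmax * Real.sqrt z) + (2 * cmax * Real.sqrt z * (θ * Real.sqrt z) +
        ∑ l : Fin (k + 1), a l * (2 * (wmax ^ 2 * (towerN n l : ℝ)) * m l))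
      = 4 * cmax * θ * (Real.sqrt z * Real.sqrt z) +
          ∑ l : Fin (k + 1), a l * (2 * (wmax ^ 2 * (towerN n l : ℝ)) * m l) := by ring
    _ = _ := by rw [hz]

/-- **‖G′_□‖ ≤ σ_k⁻¹ for the Dirichlet inverse of the tower operator on Ω₀ = {χ = 1}** (the levels covering Ω₀; block
weights W_l = w_l∘towerBlk_l; σ_k = `sigmaTower`) — pv21's `towerDir_sq_le` in `L2Bound` form. [folklore] -/
theorem l2Bound_dirInv_tower (hRm : ∀ b i j, ∑ k, Rm b k i * Rm b k j = if i = j then (1 : ℝ) else 0)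
    {c : Bd → ℝ} {cmin : ℝ} (hcmin : 0 < cmin) (hc : ∀ b, cmin ≤ |c b|) {D n : ℕ → ℕ}
    (hD : ∀ j x, (Ks j).depth x ≤ D j) (hn : ∀ j β, (univ.filter fun x => (Ks j).blk x = β).card ≤ n j)
    (k : ℕ) (w : Fin (k + 1) → St → ℝ) {a : Fin (k + 1) → ℝ} (ha : ∀ l, 0 ≤ a l) {amin wmin : ℝ}
    (hamin : 0 < amin) (hwmin : 0 < wmin) {χ : St × Cp → ℝ} (hχ : ∀ p, χ p = 0 ∨ χ p = 1)
    (hcov : ∀ x i, χ (x, i) = 1 → ∃ l : Fin (k + 1), amin ≤ a l ∧ wmin ≤ |w l (towerBlk Ks (l : ℕ) x)|) :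
    L2Bound (dirInv (towerOp Ks Rm c k (fun l x => w l (towerBlk Ks (l : ℕ) x)) a) χ)
      (sigmaTower amin wmin cmin D n k)⁻¹ := by
  have hσ := sigmaTower_pos cmin D n k hamin hwmin
  refine ⟨inv_nonneg.mpr hσ.le, fun g => ?_⟩
  rw [inv_pow]
  exact towerDir_sq_le Ks Rm hRm hcmin hc hD hn k w ha hamin hwmin hχ hcov g

omit [DecidableEq St] [Fintype Bd] [DecidableEq Cp] [∀ j, Fintype (Bs j)] [∀ j, DecidableEq (Bs j)] in
/-- ‖M_h‖ ≤ 1 for 0 ≤ h ≤ 1 (as a site multiplier on the fields). [folklore] -/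
theorem l2Bound_mulOp_of_unit {h : St → ℝ} (hh : ∀ x, |h x| ≤ 1) :
    L2Bound (mulOp (h ∘ Prod.fst) : Module.End ℝ (St × Cp → ℝ)) 1 :=
  l2Bound_mulOp zero_le_one fun p => hh p.1

/-- **THE REMAINDER TERM K(h)G′_□M_h IN ℓ² (MODEL of one summand of R′ in (3.89)–(3.90))**: under the hypotheses of
`l2Bound_towerK` and `l2Bound_dirInv_tower` and |h| ≤ 1:
‖K(h)∘G′_□∘M_h‖ ≤ (4c_maxθz + Σ_l a_l·2w_max²N_l·m_l)·σ_k⁻¹. [folklore] -/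
theorem l2Bound_remainderTerm (hRm : ∀ b i j, ∑ k, Rm b k i * Rm b k j = if i = j then (1 : ℝ) else 0)
    {c : Bd → ℝ} {cmin cmax : ℝ} (hcmin : 0 < cmin) (hc : ∀ b, cmin ≤ |c b|) (hcmax : 0 ≤ cmax)
    (hc' : ∀ b, |c b| ≤ cmax) {z : ℕ}
    (hzs : ∀ x, (univ.filter fun b => src b = x).card ≤ z) (hzt : ∀ x, (univ.filter fun b => tgt b = x).card ≤ z)
    {D n : ℕ → ℕ} (hD : ∀ j x, (Ks j).depth x ≤ D j)
    (hn : ∀ j β, (univ.filter fun x => (Ks j).blk x = β).card ≤ n j) (k : ℕ) (w : Fin (k + 1) → St → ℝ)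
    {wmax : ℝ} (hwmax : 0 ≤ wmax) (hw' : ∀ l y, |w l y| ≤ wmax) {a : Fin (k + 1) → ℝ} (ha : ∀ l, 0 ≤ a l)
    {amin wmin : ℝ} (hamin : 0 < amin) (hwmin : 0 < wmin) {χ : St × Cp → ℝ} (hχ : ∀ p, χ p = 0 ∨ χ p = 1)
    (hcov : ∀ x i, χ (x, i) = 1 → ∃ l : Fin (k + 1), amin ≤ a l ∧ wmin ≤ |w l (towerBlk Ks (l : ℕ) x)|)
    (h : St → ℝ) (hh : ∀ x, |h x| ≤ 1) {θ : ℝ} (hθ : 0 ≤ θ) (hdh : ∀ b, |c b * (h (tgt b) - h (src b))| ≤ θ)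
    {m : Fin (k + 1) → ℝ} (hm : ∀ l, 0 ≤ m l) (hδ : ∀ (l : Fin (k + 1)) x, |h x - h (towerBlk Ks (l : ℕ) x)| ≤ m l) :
    L2Bound (towerK Ks Rm c k (fun l x => w l (towerBlk Ks (l : ℕ) x)) a h *
        dirInv (towerOp Ks Rm c k (fun l x => w l (towerBlk Ks (l : ℕ) x)) a) χ * mulOp (h ∘ Prod.fst))
      ((4 * cmax * θ * z + ∑ l : Fin (k + 1), a l * (2 * (wmax ^ 2 * (towerN n l : ℝ)) * m l)) *
        (sigmaTower amin wmin cmin D n k)⁻¹) := by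
  have hK := l2Bound_towerK Ks Rm hRm hcmax hc' hzs hzt hn k (W := fun l x => w l (towerBlk Ks (l : ℕ) x)) hwmax
    (fun l x => hw' l _) ha h hθ hdh hm hδ
  have hG := l2Bound_dirInv_tower Ks Rm hRm hcmin hc hD hn k w ha hamin hwmin hχ hcov
  have hM : L2Bound (mulOp (h ∘ Prod.fst) : Module.End ℝ (St × Cp → ℝ)) 1 := l2Bound_mulOp_of_unit hh
  have hb := (hK.comp hG).comp hM
  refine (hb.of_eq rfl).mono (le_of_eq ?_)
  ring

end Tower

/-! ## §3  The torus with the b05 partition of unity: each remainder term is O(1/M₀) -/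

section Torus

variable {d : ℕ} {N : Fin d → ℕ} [∀ i, NeZero (N i)] [NeZero d]

/-- MODEL bookkeeping: **the remainder constant of the torus tower**,
C_rem = 4d·(4c_max²d + 2w_max²Σ_l a_lN_lS_l)·σ_k⁻¹ with N_l = `towerN (j ↦ M_j^d) l`, S_l = `towerS (j ↦ d(M_j − 1)) l`,
σ_k = `sigmaTowerTorus d M a_min w_min c_min k` — independent of the volume, the transport, the box and M₀. [folklore] -/
def remConstTower (d : ℕ) (M : ℕ → ℕ) (amin wmin cmin cmax wmax : ℝ) (k : ℕ) (a : Fin (k + 1) → ℝ) : ℝ :=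
  4 * d * (4 * cmax ^ 2 * d + 2 * wmax ^ 2 *
      ∑ l : Fin (k + 1), a l * (towerN (fun j => M j ^ d) l : ℝ) * (towerS (fun j => d * (M j - 1)) l : ℝ)) *
    (sigmaTowerTorus d M amin wmin cmin k)⁻¹

/-- **EACH PARAMETRIX REMAINDER TERM IS O(1/M₀) IN ℓ², UNIFORMLY IN THE VOLUME, THE TRANSPORT AND THE BOX (MODEL of one
summand of R′ = Σ_□K(h_□)G′_□h_□ in (3.89)–(3.90)).**  Torus `UT N`, cube-comb tower of sides M_j (1 ≤ M_j, M_j ∣ N_i),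
every isometric transport, c_min ≤ |c| ≤ c_max, block weights |w_l| ≤ w_max with the cover of Ω₀ = {χ = 1} (a_l ≥ a_min,
|w_l| ≥ w_min somewhere above every site of Ω₀), a_l ≥ 0, the partition function h_z = `hSU N M₀ z` of [B5] (1.118) at
scale M₀ ≥ 1 and ANY centre z:  for every v,
Σ_p ((K(h_z)G′_{Ω₀}M_{h_z})v)(p)² ≤ (C_rem/M₀)²·Σ_p v(p)², C_rem = `remConstTower d M a_min w_min c_min c_max w_max k a`.
Ingredients: |∂h_z| ≤ 4d/M₀ per bond (`hSU_lipschitz`), hence |c∂h_z| ≤ c_max·4d/M₀ and the level-l block oscillation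
|h_z(x) − h_z(towerBlk_l x)| ≤ S_l·4d/M₀ (`CovariantTowerDecay.abs_sub_towerBlk_le`); 0 ≤ h_z ≤ 1; z = d bonds per site.
[folklore] -/
theorem remainderTerm_le_torus {Cp : Type} [Fintype Cp] [DecidableEq Cp] {M : ℕ → ℕ} (hM : ∀ j, 1 ≤ M j)
    (hdiv : ∀ j i, M j ∣ N i) (c : UT N × Fin d → ℝ) {cmin cmax : ℝ} (hcmin : 0 < cmin) (hc : ∀ b, cmin ≤ |c b|)
    (hc' : ∀ b, |c b| ≤ cmax) (Rm : UT N × Fin d → Cp → Cp → ℝ)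
    (hRm : ∀ b i j, ∑ k, Rm b k i * Rm b k j = if i = j then (1 : ℝ) else 0) (k : ℕ)
    (w : Fin (k + 1) → UT N → ℝ) {wmax : ℝ} (hw' : ∀ l y, |w l y| ≤ wmax) {a : Fin (k + 1) → ℝ} (ha : ∀ l, 0 ≤ a l)
    {amin wmin : ℝ} (hamin : 0 < amin) (hwmin : 0 < wmin) {χ : UT N × Cp → ℝ} (hχ : ∀ p, χ p = 0 ∨ χ p = 1)
    (hcov : ∀ x i, χ (x, i) = 1 →
      ∃ l : Fin (k + 1), amin ≤ a l ∧ wmin ≤ |w l (towerBlk (torusTower hM hdiv) (l : ℕ) x)|)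
    {M₀ : ℕ} (hM₀ : 1 ≤ M₀) (z : Ctr N M₀) :
    L2Bound (towerK (torusTower hM hdiv) Rm c k (fun l x => w l (towerBlk (torusTower hM hdiv) (l : ℕ) x)) a
          (hSU N M₀ z) *
        dirInv (towerOp (torusTower hM hdiv) Rm c k (fun l x => w l (towerBlk (torusTower hM hdiv) (l : ℕ) x)) a) χ *
        mulOp (hSU N M₀ z ∘ Prod.fst))
      (remConstTower d M amin wmin cmin cmax wmax k a / M₀) := by
  have hd0 : 0 < d := Nat.pos_of_ne_zero (NeZero.ne d)
  have hM0 : (0 : ℝ) < M₀ := by exact_mod_cast hM₀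
  set x₀ : UT N := ctrU N M₀ z with hx₀
  have hcmax : 0 ≤ cmax := (abs_nonneg _).trans (hc' (x₀, ⟨0, hd0⟩))
  have hwmax : 0 ≤ wmax := (abs_nonneg _).trans (hw' 0 x₀)
  set θb : ℝ := 4 * d / M₀ with hθb
  have hθb0 : 0 ≤ θb := by positivity
  -- per-bond Lipschitz bound of h_z and its c-weighted form
  have hlip : ∀ b : UT N × Fin d, |hSU N M₀ z (btgt b) - hSU N M₀ z (bsrc b)| ≤ θb := by
    rintro ⟨y, μ⟩
    rw [btgt_apply, bsrc_apply]
    have h1 := hSU_lipschitz N hM₀ z (up y μ) y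
    have h2 : dist (up y μ) y ≤ 1 := by rw [dist_comm]; exact dist_up_le y μ
    calc |hSU N M₀ z (up y μ) - hSU N M₀ z y| ≤ 4 * d / M₀ * dist (up y μ) y := h1
      _ ≤ 4 * d / M₀ * 1 := mul_le_mul_of_nonneg_left h2 hθb0
      _ = θb := mul_one _
  have hdh : ∀ b : UT N × Fin d, |c b * (hSU N M₀ z (btgt b) - hSU N M₀ z (bsrc b))| ≤ cmax * θb := fun b => by
    rw [abs_mul]
    exact mul_le_mul (hc' b) (hlip b) (abs_nonneg _) hcmax
  have hδ : ∀ (l : Fin (k + 1)) (x : UT N),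
      |hSU N M₀ z x - hSU N M₀ z (towerBlk (torusTower hM hdiv) (l : ℕ) x)| ≤
        (towerS (fun j => d * (M j - 1)) (l : ℕ) : ℝ) * θb := fun l x =>
    abs_sub_towerBlk_le (torusTower hM hdiv) (hSU N M₀ z) hθb0 hlip (D := fun j => d * (M j - 1))
      (fun j y => tdepth_le (hM j) y) (l : ℕ) x
  have hh : ∀ x : UT N, |hSU N M₀ z x| ≤ 1 := fun x => hh_torus M₀ z x
  have hmain := l2Bound_remainderTerm (torusTower hM hdiv) Rm hRm hcmin hc hcmax hc' card_filter_bsrc_le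
    card_filter_btgt_le (fun j y => tdepth_le (hM j) y) (fun j β => card_block_le (hM j) (hdiv j) β) k w hwmax hw' ha
    hamin hwmin hχ hcov (hSU N M₀ z) hh (mul_nonneg hcmax hθb0) hdh (fun l => by positivity) hδ
  refine hmain.mono (le_of_eq ?_)
  have key : ∀ l : Fin (k + 1), a l * (2 * (wmax ^ 2 * (towerN (fun j => M j ^ d) l : ℝ)) *
        ((towerS (fun j => d * (M j - 1)) (l : ℕ) : ℝ) * θb)) =
      θb * (2 * wmax ^ 2) * (a l * (towerN (fun j => M j ^ d) l : ℝ) * (towerS (fun j => d * (M j - 1)) l : ℝ)) :=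
    fun l => by ring
  simp only [key, ← Finset.mul_sum]
  rw [hθb]
  unfold remConstTower sigmaTowerTorus
  field_simp

/-- **The same with the cover DISCHARGED by the top level** (uniform block weights w_l ≡ ω_l with a_k ≥ a_min > 0 and
|ω_k| ≥ w_min > 0, the regime of pv21's `eq388_tower_torus_top`): every remainder term of the parametrix of the k-fold
tower operator is O(1/M₀) in ℓ² with NO hypothesis beyond the data. [folklore] -/
theorem remainderTerm_le_torus_top {Cp : Type} [Fintype Cp] [DecidableEq Cp] {M : ℕ → ℕ} (hM : ∀ j, 1 ≤ M j)
    (hdiv : ∀ j i, M j ∣ N i) (c : UT N × Fin d → ℝ) {cmin cmax : ℝ} (hcmin : 0 < cmin) (hc : ∀ b, cmin ≤ |c b|)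
    (hc' : ∀ b, |c b| ≤ cmax) (Rm : UT N × Fin d → Cp → Cp → ℝ)
    (hRm : ∀ b i j, ∑ k, Rm b k i * Rm b k j = if i = j then (1 : ℝ) else 0) (k : ℕ) (ω : Fin (k + 1) → ℝ)
    {wmax : ℝ} (hw' : ∀ l, |ω l| ≤ wmax) {a : Fin (k + 1) → ℝ} (ha : ∀ l, 0 ≤ a l) {amin wmin : ℝ}
    (hamin : 0 < amin) (hwmin : 0 < wmin) (hak : amin ≤ a (Fin.last k)) (hωk : wmin ≤ |ω (Fin.last k)|)
    {χ : UT N × Cp → ℝ} (hχ : ∀ p, χ p = 0 ∨ χ p = 1) {M₀ : ℕ} (hM₀ : 1 ≤ M₀) (z : Ctr N M₀) :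
    L2Bound (towerK (torusTower hM hdiv) Rm c k (fun l _ => ω l) a (hSU N M₀ z) *
        dirInv (towerOp (torusTower hM hdiv) Rm c k (fun l _ => ω l) a) χ * mulOp (hSU N M₀ z ∘ Prod.fst))
      (remConstTower d M amin wmin cmin cmax wmax k a / M₀) :=
  remainderTerm_le_torus hM hdiv c hcmin hc hc' Rm hRm k (fun l _ => ω l) (fun l _ => hw' l) ha hamin hwmin hχ
    (fun _ _ _ => ⟨Fin.last k, hak, hωk⟩) hM₀ z

end Torus

end

end Summit.QuantumFields.BalabanUV.Beta.CovariantTowerRemainder
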